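import Summits.QuantumFields.YangMills.Theorems.IR.AfPincerUcXPoly
import Summits.QuantumFields.YangMills.Theorems.BalabanLadderNTReferenceTorusPackage
import HarnessLib

/-!
# Crux `NT` (stmt-QuantumFields-19353): UNIT NORMAL FORM — the clause `a(β) → 0` is REDUNDANT, and `NT` is a
# statement about each coupling separately

Helper file (`--supports stmt-QuantumFields-19353`) of the fleet lead prover of crux `NT` (unit `ym-spine-19353-p1`,
g11), hypothesis-free.  The crux reads `∃ (r, a), (∀ β, 0 < a β) ∧ Tendsto a atTop (𝓝 0) ∧ LowerBounds G r a`
(«CALIBRATING form: NT FIXES the units»).  The tree's volume-uniform weak-coupling ceiling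
`AfOnset.exists_abs_Q2_le_log_sq` (`|Q2 G r β L s f g| ≤ K (1 + log β)² / (β² · min(s,1)⁸)`, every torus, every unit;
chessboard moments, seat ym-19354-afpincer-s2) makes the middle conjunct a CONSEQUENCE of the floor (the IR desk recorded
the by-product `AfPincerUc.unit_calibration_of_lowerBounds`; here it is sharpened to ONE torus per coupling and read
for the crux):

* §1 `unit_calibration_of_q2Floor` — a positive unit map carrying the two-point floor `ε ≤ Q2 G r β L (a β) f g` on
  SOME torus `L ≥ 1` for every large `β` (ANY pair of test functions) satisfies `min(a β, 1)⁸ · β² ≤ K (1 + log β)²`;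
  `unit_pow_eight_le_of_q2Floor` — hence eventually `a β < 1` and **`a β ^ 8 ≤ K (1 + log β)² / β²`**, i.e.
  `a(β) ≤ K^{1/8} · ((1 + log β)/β)^{1/4}`; `tendsto_zero_of_q2Floor`, `tendsto_zero_of_lowerBounds` — `a → 0`.
* §2 **`nt_iff_pos_lowerBounds`** — `BalabanLadder.NT ↔ ∀ G simple, ∃ (r, a), (∀ β, 0 < a β) ∧ LowerBounds G r a`
  (the limit clause dropped); **`nt_iff_pointwise`** — `NT ↔` «for every compact simple `G` there are `r`, ONE witness
  `v` (positive time), `ε > 0`, three pairwise-disjointly supported `f, g, h`, `ε' > 0` and thresholds such that AT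
  EVERY COUPLING `β` SOME unit `s > 0` carries both floors on all tori `2L+1` with `Λ ≤ s · L`»: no rate, no limit, no
  monotonicity and no explicit formula for the unit is part of the claim — the unit map is ANY selector of the per-β
  feasible set (by choice), and its vanishing is automatic (§1).  (The crux-ideate desk ym-cruxidea-19353-2 g9 typed the
  weaker equivalence with an explicit envelope `s ≤ σ(β) → 0`, evidence #47 `ImplicitUnits.lean` on this item; the
  envelope is superfluous.)
* §3 `nt_of_torusReferencePackage_noTendsto` — the same redundancy inside the REGISTERED package: the hypothesis of the
  tree's `Reference.nt_of_torusReferencePackage` (= the body of `RefPkgT`, skeleton v4T 4297522f58b4c3a5) with its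
  conjunct `Tendsto a atTop (𝓝 0)` DELETED still gives `BalabanLadder.NT` by name (clause 4's floor with non-negative
  margin on the torus `L₀ β ≥ 1` is a two-point floor as in §1).

NUMBERS.  At the coarse end NT's unit obeys `a(β) ≤ K^{1/8}((1 + log β)/β)^{1/4}` (soft, every compact `G`); the
two-loop unit of record of the seam `UVSeamRec` is `u(β) = e^{−β/(4b₀)}·(β/(2b₀))^{b₁/(2b₀²)}`, exponentially inside
this envelope; the fine end is the mirror-Hankel cap of `…NTMirrorHankelQ2Floor` (g10): `ξ_lat(β) ≳ 1/(a(β) log(1/a(β)))`.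

HONEST FRAMING.  Elementary given the cited tree theorems; a normal form of the crux STATEMENT, nothing about its truth;
not a floor, not AF, not NT, not the seam, not the gap; not Clay.
-/

set_option autoImplicit false

noncomputable section

open scoped SchwartzMap
open MeasureTheory Filter Topology Finset
open Literature.MathematicalPhysics.QuantumFieldTheory Literature.MathematicalPhysics.QuantumLattice
open Literature.Probability.LatticeModels
open Summit.QuantumFields.YangMills.Cruxes.OSLegsFromFemtoAndGap.DlrCollarTransfer
open Summit.QuantumFields.YangMills.Cruxes.IR.AfOnset (exists_abs_Q2_le_log_sq)

namespace Summit.QuantumFields.YangMills.Cruxes.NT.UnitNormalForm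

/-! ## §1 A two-point floor calibrates the unit from the coarse side; the unit vanishes -/

section Calibration

variable {G : Type} [Group G] [TopologicalSpace G] [IsTopologicalGroup G] [CompactSpace G]
  [MeasurableSpace G] [BorelSpace G]

/-- `(1 + log β)² / β² → 0` as `β → ∞`. [folklore] -/
theorem tendsto_one_add_log_sq_div_sq :
    Tendsto (fun β : ℝ => (1 + Real.log β) ^ 2 / β ^ 2) atTop (𝓝 0) := by
  have h1 : (fun β : ℝ => 1 + Real.log β) =o[atTop] (fun β : ℝ => β) := by
    have hc : (fun _ : ℝ => (1 : ℝ)) =o[atTop] (fun β : ℝ => β) :=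
      Asymptotics.isLittleO_const_left.2
        (Or.inr (show Tendsto (fun β : ℝ => ‖β‖) atTop atTop from tendsto_norm_atTop_atTop))
    exact hc.add Real.isLittleO_log_id_atTop
  have h2 : Tendsto (fun β : ℝ => (1 + Real.log β) / β) atTop (𝓝 0) := h1.tendsto_div_nhds_zero
  have h3 := h2.pow 2
  rw [zero_pow two_ne_zero] at h3
  refine h3.congr fun β => ?_
  rw [div_pow]

/-- **A two-point floor calibrates the unit (coarse side), ONE torus per coupling.**  If a positive unit map `a`
carries `ε ≤ Q2 G r β L (a β) f g` (`ε > 0`) on SOME torus `2L+1`, `L ≥ 1`, for every `β ≥ β₅`, then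
`min(a β, 1)⁸ · β² ≤ K · (1 + log β)²` for all large `β` (`K ≥ 0` depends on `r, f, g, ε`): floor against the tree's
volume-uniform weak-coupling ceiling `AfOnset.exists_abs_Q2_le_log_sq`. [folklore] -/
theorem unit_calibration_of_q2Floor (r : LatticeRep G) (a : ℝ → ℝ) (ha : ∀ β, 0 < a β)
    (f g : 𝓢(EuclideanSpace ℝ (Fin 4), ℝ)) {ε β₅ : ℝ} (hε : 0 < ε)
    (hfloor : ∀ β : ℝ, β₅ ≤ β → ∃ L : ℕ, 1 ≤ L ∧ ε ≤ Q2 G r β L (a β) f g) :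
    ∃ K β₁ : ℝ, 0 ≤ K ∧ ∀ β : ℝ, β₁ ≤ β → (min (a β) 1) ^ 8 * β ^ 2 ≤ K * (1 + Real.log β) ^ 2 := by
  obtain ⟨K, hK0, hK⟩ := exists_abs_Q2_le_log_sq r f g
  refine ⟨K / ε, max β₅ 1, div_nonneg hK0 hε.le, fun β hβ => ?_⟩
  have hβ5 : β₅ ≤ β := le_trans (le_max_left _ _) hβ
  have hβ1 : 1 ≤ β := le_trans (le_max_right _ _) hβ
  obtain ⟨L, hL1, hlo⟩ := hfloor β hβ5
  have hup := hK L hL1 β hβ1 (a β) (ha β)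
  have hm0 : 0 < min (a β) 1 := lt_min (ha β) one_pos
  have hβ0 : 0 < β := lt_of_lt_of_le one_pos hβ1
  have hden : 0 < β ^ 2 * (min (a β) 1) ^ 8 := by positivity
  have h1 : ε ≤ K * (1 + Real.log β) ^ 2 / (β ^ 2 * (min (a β) 1) ^ 8) :=
    hlo.trans ((le_abs_self _).trans hup)
  rw [le_div_iff₀ hden] at h1
  rw [div_mul_eq_mul_div, le_div_iff₀ hε]
  linarith [mul_comm ε (β ^ 2 * (min (a β) 1) ^ 8)]

/-- **The explicit coarse-side rate.**  Under the hypotheses of `unit_calibration_of_q2Floor`: for all large `β`,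
`a β < 1` and `a β ^ 8 ≤ K (1 + log β)² / β²` — the unit is at least as fine as `K^{1/8}((1 + log β)/β)^{1/4}`.
[folklore] -/
theorem unit_pow_eight_le_of_q2Floor (r : LatticeRep G) (a : ℝ → ℝ) (ha : ∀ β, 0 < a β)
    (f g : 𝓢(EuclideanSpace ℝ (Fin 4), ℝ)) {ε β₅ : ℝ} (hε : 0 < ε)
    (hfloor : ∀ β : ℝ, β₅ ≤ β → ∃ L : ℕ, 1 ≤ L ∧ ε ≤ Q2 G r β L (a β) f g) :
    ∃ K β₁ : ℝ, 0 ≤ K ∧ ∀ β : ℝ, β₁ ≤ β →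
      a β < 1 ∧ a β ^ 8 ≤ K * (1 + Real.log β) ^ 2 / β ^ 2 := by
  obtain ⟨K, β₁, hK0, hK⟩ := unit_calibration_of_q2Floor r a ha f g hε hfloor
  -- eventually `K (1 + log β)² / β² < 1`
  have hev : ∀ᶠ β : ℝ in atTop, K * ((1 + Real.log β) ^ 2 / β ^ 2) < 1 := by
    have ht : Tendsto (fun β : ℝ => K * ((1 + Real.log β) ^ 2 / β ^ 2)) atTop (𝓝 0) := by
      simpa using tendsto_one_add_log_sq_div_sq.const_mul K
    exact ht.eventually (gt_mem_nhds one_pos)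
  obtain ⟨β₂, hβ₂⟩ := Filter.eventually_atTop.1 (hev.and (Filter.eventually_gt_atTop 0))
  refine ⟨K, max β₁ β₂, hK0, fun β hβ => ?_⟩
  have h1 := hK β (le_trans (le_max_left _ _) hβ)
  obtain ⟨h2, hβ0⟩ := hβ₂ β (le_trans (le_max_right _ _) hβ)
  have hβ2 : 0 < β ^ 2 := by positivity
  have h3 : (min (a β) 1) ^ 8 ≤ K * (1 + Real.log β) ^ 2 / β ^ 2 := by
    rw [le_div_iff₀ hβ2]; exact h1
  have h4 : K * (1 + Real.log β) ^ 2 / β ^ 2 < 1 := by rwa [mul_div_assoc]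
  have hm0 : 0 ≤ min (a β) 1 := le_min (ha β).le zero_le_one
  have hlt : min (a β) 1 < 1 := by
    by_contra hge
    rw [not_lt] at hge
    have : (1 : ℝ) ≤ (min (a β) 1) ^ 8 := one_le_pow₀ hge
    linarith
  have hmin : min (a β) 1 = a β := min_eq_left (le_of_lt (by simpa using (min_lt_iff.1 hlt)))
  exact ⟨by simpa [hmin] using hlt, by simpa [hmin] using h3⟩

/-- **The unit vanishes.**  A positive unit map carrying a two-point floor on some torus `L ≥ 1` at every large
coupling tends to `0`. [folklore] -/
theorem tendsto_zero_of_q2Floor (r : LatticeRep G) (a : ℝ → ℝ) (ha : ∀ β, 0 < a β)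
    (f g : 𝓢(EuclideanSpace ℝ (Fin 4), ℝ)) {ε β₅ : ℝ} (hε : 0 < ε)
    (hfloor : ∀ β : ℝ, β₅ ≤ β → ∃ L : ℕ, 1 ≤ L ∧ ε ≤ Q2 G r β L (a β) f g) :
    Tendsto a atTop (𝓝 0) := by
  obtain ⟨K, β₁, hK0, hK⟩ := unit_pow_eight_le_of_q2Floor r a ha f g hε hfloor
  rw [Metric.tendsto_nhds]
  intro δ hδ
  have hev : ∀ᶠ β : ℝ in atTop, K * ((1 + Real.log β) ^ 2 / β ^ 2) < δ ^ 8 := by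
    have ht : Tendsto (fun β : ℝ => K * ((1 + Real.log β) ^ 2 / β ^ 2)) atTop (𝓝 0) := by
      simpa using tendsto_one_add_log_sq_div_sq.const_mul K
    exact ht.eventually (gt_mem_nhds (by positivity))
  filter_upwards [hev, Filter.eventually_ge_atTop β₁] with β h1 h2
  obtain ⟨-, h3⟩ := hK β h2
  rw [Real.dist_eq, sub_zero, abs_of_pos (ha β)]
  have h4 : a β ^ 8 < δ ^ 8 := lt_of_le_of_lt h3 (by rw [mul_div_assoc]; exact h1)
  exact lt_of_pow_lt_pow_left₀ 8 hδ.le h4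

/-- **`LowerBounds` ⇒ `a → 0`**: for a positive unit map the limit clause of the crux `NT` follows from clause (i) of
`LowerBounds G r a` (one large torus per coupling is enough). [folklore] -/
theorem tendsto_zero_of_lowerBounds (r : LatticeRep G) (a : ℝ → ℝ) (ha : ∀ β, 0 < a β)
    (hlb : LowerBounds G r a) : Tendsto a atTop (𝓝 0) := by
  obtain ⟨⟨v, ε, β₅, Λ₅, -, hε, hfloor⟩, -⟩ := hlb
  refine tendsto_zero_of_q2Floor r a ha (thetaTest 4 v) v hε (β₅ := β₅) fun β hβ => ?_
  -- a torus large enough for the floor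
  refine ⟨⌈Λ₅ / a β⌉₊ + 1, by omega, hfloor β hβ _ ?_⟩
  have h1 : Λ₅ / a β ≤ (⌈Λ₅ / a β⌉₊ : ℝ) := Nat.le_ceil _
  have h2 : (⌈Λ₅ / a β⌉₊ : ℝ) ≤ ((⌈Λ₅ / a β⌉₊ + 1 : ℕ) : ℝ) := by push_cast; linarith
  have h3 : Λ₅ / a β ≤ ((⌈Λ₅ / a β⌉₊ + 1 : ℕ) : ℝ) := h1.trans h2
  rw [div_le_iff₀ (ha β)] at h3
  linarith [mul_comm (((⌈Λ₅ / a β⌉₊ + 1 : ℕ) : ℝ)) (a β)]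

/-- The explicit coarse-side rate for an NT unit: `LowerBounds G r a`, `0 < a` ⇒ for all large `β`, `a β < 1` and
`a β ^ 8 ≤ K (1 + log β)² / β²`. [folklore] -/
theorem unit_pow_eight_le_of_lowerBounds (r : LatticeRep G) (a : ℝ → ℝ) (ha : ∀ β, 0 < a β)
    (hlb : LowerBounds G r a) :
    ∃ K β₁ : ℝ, 0 ≤ K ∧ ∀ β : ℝ, β₁ ≤ β → a β < 1 ∧ a β ^ 8 ≤ K * (1 + Real.log β) ^ 2 / β ^ 2 := by
  obtain ⟨⟨v, ε, β₅, Λ₅, -, hε, hfloor⟩, -⟩ := hlb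
  refine unit_pow_eight_le_of_q2Floor r a ha (thetaTest 4 v) v hε (β₅ := β₅) fun β hβ => ?_
  refine ⟨⌈Λ₅ / a β⌉₊ + 1, by omega, hfloor β hβ _ ?_⟩
  have h1 : Λ₅ / a β ≤ (⌈Λ₅ / a β⌉₊ : ℝ) := Nat.le_ceil _
  have h2 : (⌈Λ₅ / a β⌉₊ : ℝ) ≤ ((⌈Λ₅ / a β⌉₊ + 1 : ℕ) : ℝ) := by push_cast; linarith
  have h3 : Λ₅ / a β ≤ ((⌈Λ₅ / a β⌉₊ + 1 : ℕ) : ℝ) := h1.trans h2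
  rw [div_le_iff₀ (ha β)] at h3
  linarith [mul_comm (((⌈Λ₅ / a β⌉₊ + 1 : ℕ) : ℝ)) (a β)]

end Calibration

/-! ## §2 Normal forms of the crux `BalabanLadder.NT` -/

/-- **`NT` without the limit clause.**  `BalabanLadder.NT` is equivalent to: for every compact simple `G` there are a
lattice representation `r` and a POSITIVE unit map `a` with `LowerBounds G r a` — `a → 0` is automatic
(`tendsto_zero_of_lowerBounds`). [folklore] -/
theorem nt_iff_pos_lowerBounds :
    Summit.QuantumFields.YangMills.Theses.BalabanLadder.NT ↔
      ∀ (G : Type) [Group G] [TopologicalSpace G] [IsTopologicalGroup G] [CompactSpace G],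
        IsCompactSimpleLieGroup G → letI : MeasurableSpace G := borel G; haveI : BorelSpace G := ⟨rfl⟩;
        ∃ (r : LatticeRep G) (a : ℝ → ℝ), (∀ β, 0 < a β) ∧ LowerBounds G r a := by
  constructor
  · intro h G _ _ _ _ hG
    letI : MeasurableSpace G := borel G
    haveI : BorelSpace G := ⟨rfl⟩
    obtain ⟨r, a, ha, -, hlb⟩ := h G hG
    exact ⟨r, a, ha, hlb⟩
  · intro h G _ _ _ _ hG
    letI : MeasurableSpace G := borel G
    haveI : BorelSpace G := ⟨rfl⟩
    obtain ⟨r, a, ha, hlb⟩ := h G hG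
    exact ⟨r, a, ha, tendsto_zero_of_lowerBounds r a ha hlb, hlb⟩

/-- **`NT` pointwise in the coupling.**  `BalabanLadder.NT` is equivalent to: for every compact simple `G` there are
`r`, one real test function `v` supported at positive times with `ε > 0` and thresholds `β₅, Λ₅`, and three real test
functions `f, g, h` with pairwise disjoint supports, `ε' > 0`, thresholds `β₅', Λ₅'`, such that FOR EVERY COUPLING `β`
SOME unit `s > 0` carries clause (i) (`β ≥ β₅`: `ε ≤ Q2 G r β L s (θv) v` for all `L` with `Λ₅ ≤ s L`) and clause (ii)
(`β ≥ β₅'`: `ε' ≤ |Q3 G r β L s f g h|` for all `L` with `Λ₅' ≤ s L`).  The unit map of `NT` is any selector of these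
per-coupling units (choice); its vanishing is `tendsto_zero_of_lowerBounds`. [folklore] -/
theorem nt_iff_pointwise :
    Summit.QuantumFields.YangMills.Theses.BalabanLadder.NT ↔
      ∀ (G : Type) [Group G] [TopologicalSpace G] [IsTopologicalGroup G] [CompactSpace G],
        IsCompactSimpleLieGroup G → letI : MeasurableSpace G := borel G; haveI : BorelSpace G := ⟨rfl⟩;
        ∃ (r : LatticeRep G) (v : 𝓢(EuclideanSpace ℝ (Fin 4), ℝ)) (ε β₅ Λ₅ : ℝ)
          (f g h : 𝓢(EuclideanSpace ℝ (Fin 4), ℝ)) (ε' β₅' Λ₅' : ℝ),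
          tsupport (v : EuclideanSpace ℝ (Fin 4) → ℝ) ⊆ {y | 0 < y 0} ∧ 0 < ε ∧
          Disjoint (tsupport (f : EuclideanSpace ℝ (Fin 4) → ℝ)) (tsupport (g : EuclideanSpace ℝ (Fin 4) → ℝ)) ∧
          Disjoint (tsupport (g : EuclideanSpace ℝ (Fin 4) → ℝ)) (tsupport (h : EuclideanSpace ℝ (Fin 4) → ℝ)) ∧
          Disjoint (tsupport (f : EuclideanSpace ℝ (Fin 4) → ℝ)) (tsupport (h : EuclideanSpace ℝ (Fin 4) → ℝ)) ∧
          0 < ε' ∧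
          ∀ β : ℝ, ∃ s : ℝ, 0 < s ∧
            (β₅ ≤ β → ∀ L : ℕ, Λ₅ ≤ s * L → ε ≤ Q2 G r β L s (thetaTest 4 v) v) ∧
            (β₅' ≤ β → ∀ L : ℕ, Λ₅' ≤ s * L → ε' ≤ |Q3 G r β L s f g h|) := by
  rw [nt_iff_pos_lowerBounds]
  constructor
  · intro hNT G _ _ _ _ hG
    letI : MeasurableSpace G := borel G
    haveI : BorelSpace G := ⟨rfl⟩
    obtain ⟨r, a, ha, ⟨v, ε, β₅, Λ₅, hv, hε, h2⟩, ⟨f, g, h, ε', β₅', Λ₅', hfg, hgh, hfh, hε', h3⟩⟩ := hNT G hG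
    exact ⟨r, v, ε, β₅, Λ₅, f, g, h, ε', β₅', Λ₅', hv, hε, hfg, hgh, hfh, hε', fun β =>
      ⟨a β, ha β, fun hβ => h2 β hβ, fun hβ => h3 β hβ⟩⟩
  · intro hP G _ _ _ _ hG
    letI : MeasurableSpace G := borel G
    haveI : BorelSpace G := ⟨rfl⟩
    obtain ⟨r, v, ε, β₅, Λ₅, f, g, h, ε', β₅', Λ₅', hv, hε, hfg, hgh, hfh, hε', hpt⟩ := hP G hG
    choose a ha h2 h3 using hpt
    exact ⟨r, a, ha, ⟨v, ε, β₅, Λ₅, hv, hε, fun β hβ => h2 β hβ⟩,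
      ⟨f, g, h, ε', β₅', Λ₅', hfg, hgh, hfh, hε', fun β hβ => h3 β hβ⟩⟩

/-! ## §3 The same redundancy inside the registered package `RefPkgT` -/

/-- **`BalabanLadder.NT` from the periodic reference package WITHOUT its limit clause.**  The hypothesis is the body
of the registered stub `stub_refpkgT : RefPkgT` (= the hypothesis of the tree's `Reference.nt_of_torusReferencePackage`)
with the conjunct `Tendsto a atTop (𝓝 0)` deleted: clause 4 (a floor `ε + margin ≤ Q2` with non-negative margin on one
torus `L₀ β ≥ 1` per coupling) calibrates the unit by §1, and the tree's composition concludes. [folklore] -/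
theorem nt_of_torusReferencePackage_noTendsto
    (h : ∀ (G : Type) [Group G] [TopologicalSpace G] [IsTopologicalGroup G] [CompactSpace G],
      IsCompactSimpleLieGroup G → letI : MeasurableSpace G := borel G; haveI : BorelSpace G := ⟨rfl⟩;
      ∃ (r : LatticeRep G) (a : ℝ → ℝ), (∀ β, 0 < a β) ∧
      ∃ (C₁ C₂ C₃ ℓ σ κ : ℝ), 0 ≤ C₁ ∧ 0 ≤ C₂ ∧ 0 ≤ C₃ ∧ 0 < σ ∧ 0 < κ ∧ 2 * (σ + κ) < ℓ ∧
      (∃ β₁ : ℝ, ∀ β : ℝ, β₁ ≤ β → ∀ (c : Fin 4 → ℤ) (b : ℕ), (b : ℝ) * a β ≤ ℓ →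
        ∀ (η η' : LGConfig 4 G) (x : Fin 4 → ℤ), 1 ≤ depth c b x →
          |kerE G r β c b η (dens G r x) - kerE G r β c b η' (dens G r x)| ≤ C₁ / (depth c b x : ℝ) ^ 4) ∧
      (∃ β₂ : ℝ, ∀ β : ℝ, β₂ ≤ β → ∀ (c : Fin 4 → ℤ) (b : ℕ), (b : ℝ) * a β ≤ ℓ →
        ∀ (η η' : LGConfig 4 G) (x y : Fin 4 → ℤ), 1 ≤ depth c b x → 1 ≤ depth c b y →
          |kerCov G r β c b η (dens G r x) (dens G r y) - kerCov G r β c b η' (dens G r x) (dens G r y)| ≤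
            C₂ / ((min (depth c b x) (depth c b y) : ℕ) : ℝ) ^ 4 / (1 + ‖siteToE (y - x)‖) ^ 4) ∧
      (∃ β₃ : ℝ, ∀ β : ℝ, β₃ ≤ β → ∀ (c : Fin 4 → ℤ) (b : ℕ), (b : ℝ) * a β ≤ ℓ →
        ∀ (η η' : LGConfig 4 G) (x y z : Fin 4 → ℤ), 1 ≤ depth c b x → 1 ≤ depth c b y → 1 ≤ depth c b z →
          |kerK3 G r β c b η x y z - kerK3 G r β c b η' x y z| ≤
            C₃ / ((min (min (depth c b x) (depth c b y)) (depth c b z) : ℕ) : ℝ) ^ 4 /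
              (1 + min (min ‖siteToE (y - x)‖ ‖siteToE (z - y)‖) ‖siteToE (z - x)‖) ^ 8) ∧
      (∃ (v : 𝓢(EuclideanSpace ℝ (Fin 4), ℝ)) (ε β₅ : ℝ) (L₀ : ℝ → ℕ),
        tsupport (v : EuclideanSpace ℝ (Fin 4) → ℝ) ⊆ {y | 0 < y 0} ∧
        tsupport (v : EuclideanSpace ℝ (Fin 4) → ℝ) ⊆ Metric.closedBall 0 σ ∧ 0 < ε ∧
        ∀ β : ℝ, β₅ ≤ β → σ + κ + 1 ≤ a β * L₀ β ∧
          ε + 2 * (C₁ * (a β / κ) ^ 4 * ∑ x ∈ box 4 (L₀ β), |thetaTest 4 v (a β • siteToE x)|) *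
                (C₁ * (a β / κ) ^ 4 * ∑ y ∈ box 4 (L₀ β), |v (a β • siteToE y)|) +
              C₂ * (a β / κ) ^ 4 * ∑ x ∈ box 4 (L₀ β), ∑ y ∈ box 4 (L₀ β),
                |thetaTest 4 v (a β • siteToE x)| * |v (a β • siteToE y)| / (1 + ‖siteToE (y - x)‖) ^ 4 ≤
            Q2 G r β (L₀ β) (a β) (thetaTest 4 v) v) ∧
      (∃ (f g h : 𝓢(EuclideanSpace ℝ (Fin 4), ℝ)) (ε β₅ : ℝ) (L₀ : ℝ → ℕ),
        Disjoint (tsupport (f : EuclideanSpace ℝ (Fin 4) → ℝ)) (tsupport (g : EuclideanSpace ℝ (Fin 4) → ℝ)) ∧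
        Disjoint (tsupport (g : EuclideanSpace ℝ (Fin 4) → ℝ)) (tsupport (h : EuclideanSpace ℝ (Fin 4) → ℝ)) ∧
        Disjoint (tsupport (f : EuclideanSpace ℝ (Fin 4) → ℝ)) (tsupport (h : EuclideanSpace ℝ (Fin 4) → ℝ)) ∧
        tsupport (f : EuclideanSpace ℝ (Fin 4) → ℝ) ⊆ Metric.closedBall 0 σ ∧
        tsupport (g : EuclideanSpace ℝ (Fin 4) → ℝ) ⊆ Metric.closedBall 0 σ ∧
        tsupport (h : EuclideanSpace ℝ (Fin 4) → ℝ) ⊆ Metric.closedBall 0 σ ∧ 0 < ε ∧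
        ∀ β : ℝ, β₅ ≤ β → σ + κ + 1 ≤ a β * L₀ β ∧
          ε + ∑ x ∈ box 4 (L₀ β), ∑ y ∈ box 4 (L₀ β), ∑ z ∈ box 4 (L₀ β),
              |f (a β • siteToE x)| * |g (a β • siteToE y)| * |h (a β • siteToE z)| *
                (2 * ((C₁ * (a β / κ) ^ 4) * (C₂ * (a β / κ) ^ 4 / (1 + ‖siteToE (z - y)‖) ^ 4) +
                      (C₁ * (a β / κ) ^ 4) * (C₂ * (a β / κ) ^ 4 / (1 + ‖siteToE (z - x)‖) ^ 4) +
                      (C₁ * (a β / κ) ^ 4) * (C₂ * (a β / κ) ^ 4 / (1 + ‖siteToE (y - x)‖) ^ 4) +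
                      (C₁ * (a β / κ) ^ 4) * (C₁ * (a β / κ) ^ 4) * (C₁ * (a β / κ) ^ 4)) +
                  C₃ * (a β / κ) ^ 4 /
                    (1 + min (min ‖siteToE (y - x)‖ ‖siteToE (z - y)‖) ‖siteToE (z - x)‖) ^ 8) ≤
            |Q3 G r β (L₀ β) (a β) f g h|)) :
    Summit.QuantumFields.YangMills.Theses.BalabanLadder.NT := by
  refine Reference.nt_of_torusReferencePackage fun G _ _ _ _ hG => ?_
  letI : MeasurableSpace G := borel G
  haveI : BorelSpace G := ⟨rfl⟩
  obtain ⟨r, a, ha₀, C₁, C₂, C₃, ℓ, σ, κ, hC₁, hC₂, hC₃, hσ, hκ, hℓ, hE1, hE2, hE3, hR2, hR3⟩ := h G hG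
  refine ⟨r, a, ha₀, ?_, C₁, C₂, C₃, ℓ, σ, κ, hC₁, hC₂, hC₃, hσ, hκ, hℓ, hE1, hE2, hE3, hR2, hR3⟩
  -- the limit clause from clause 4
  obtain ⟨v, ε, β₅, L₀, -, -, hε, hR⟩ := hR2
  refine tendsto_zero_of_q2Floor r a ha₀ (thetaTest 4 v) v hε (β₅ := β₅) fun β hβ => ?_
  obtain ⟨hfit, hfl⟩ := hR β hβ
  refine ⟨L₀ β, ?_, le_trans ?_ hfl⟩
  · -- `σ + κ + 1 ≤ a β · L₀ β` forces `L₀ β ≥ 1`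
    by_contra h0
    have hL0 : L₀ β = 0 := by omega
    rw [hL0, Nat.cast_zero, mul_zero] at hfit
    linarith
  · -- the margin is non-negative
    have hk : 0 ≤ C₁ * (a β / κ) ^ 4 := mul_nonneg hC₁ (pow_nonneg (div_nonneg (ha₀ β).le hκ.le) _)
    have h1 : 0 ≤ 2 * (C₁ * (a β / κ) ^ 4 * ∑ x ∈ box 4 (L₀ β), |thetaTest 4 v (a β • siteToE x)|) *
        (C₁ * (a β / κ) ^ 4 * ∑ y ∈ box 4 (L₀ β), |v (a β • siteToE y)|) :=
      mul_nonneg (mul_nonneg zero_le_two (mul_nonneg hk (sum_nonneg fun _ _ => abs_nonneg _)))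
        (mul_nonneg hk (sum_nonneg fun _ _ => abs_nonneg _))
    have h2 : 0 ≤ C₂ * (a β / κ) ^ 4 * ∑ x ∈ box 4 (L₀ β), ∑ y ∈ box 4 (L₀ β),
        |thetaTest 4 v (a β • siteToE x)| * |v (a β • siteToE y)| / (1 + ‖siteToE (y - x)‖) ^ 4 :=
      mul_nonneg (mul_nonneg hC₂ (pow_nonneg (div_nonneg (ha₀ β).le hκ.le) _))
        (sum_nonneg fun _ _ => sum_nonneg fun _ _ => by positivity)
    linarith

end Summit.QuantumFields.YangMills.Cruxes.NT.UnitNormalForm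

end
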